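import Literature.NumberTheory.EllipticCurves.Shintani32KohnenWeight
import Literature.NumberTheory.EllipticCurves.ShintaniGenusSymmetry
import Mathlib.Data.Nat.ChineseRemainder
import HarnessLib

/-!
# Genus characters on a square class are trivial; symmetry of Kohnen's weights

[[cite: Shintani1975, §2, Thm. 2]] — the arithmetic behind the symmetry
`a_{Φ_D}(D₀) = a_{Φ_{D₀}}(D)` (hypothesis (H2) of the symmetric-family endgame
`TunnellWaldspurgerSymmetricFamilyProofs`) for the Kohnen-type lifts on the full level-`32` lattice
(`Shintani32KohnenWeight.kohnenWt`; Gross–Kohnen–Zagier II, §I.2: the generalized genus character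
`χ_{Δ₁}` of discriminant `Δ = Δ₁ Δ₂` equals `χ_{Δ₂}`; in particular it is TRIVIAL when `Δ₂` is a
square).  PROVED:

* `kohnenWt_eq_one_of_discK_eq_sq_mul` — for odd square-free `m ≡ 1 (mod 4)`, `s` odd and `k` with
  `Δ(k) = s² m` non-degenerate modulo the primes of `s`, `χ_m(Q_k) = 1`: with a represented value
  `r = Q_k(σ, 1)` odd and prime to `s m` (Chinese remainder), `χ_m(Q_k) = (r/m) = (m/|r|) =
  (s²m/|r|) = (L²/|r|) = 1` (`128 k₀ r = L² - Δ`);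
* consequences: `kohnenWt_eq_one_of_discK_eq` (class `1`: `χ_D(Q) = 1` on `Δ = D`),
  `kohnenWt_eq_kohnenWt_three` (class `3`, auxiliary index `3`: `χ_{D*}(Q) = χ_{-3}(Q)` on
  `Δ = 3D`, including `3 ∣ D`), `kohnenWt_mul`.

No named facts, no definitions.
-/

namespace Literature.NumberTheory.EllipticCurves.Shintani

open Finset

/-! ### Represented values prime to a finite set of primes -/

/-- The values of `σ ↦ Q_k(σ, 1)` at `σ = 0, 1, -1` cannot all vanish modulo an odd prime `p` unless
`p` divides `k₀, k₁, k₂`. [folklore] -/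
theorem exists_binValK_not_dvd_of_prime {p : ℕ} (hp : p.Prime) (hp2 : p ≠ 2) {k : Fin 3 → ℤ}
    (hk : ¬ ((p : ℤ) ∣ k 0 ∧ (p : ℤ) ∣ k 1 ∧ (p : ℤ) ∣ k 2)) :
    ∃ a : ℕ, ¬ (p : ℤ) ∣ binValK k a 1 := by
  by_contra hcon
  push Not at hcon
  have h0 := hcon 0
  have h1 := hcon 1
  have hm1 : (p : ℤ) ∣ binValK k (-1) 1 := by
    have hp1 : 1 ≤ p := hp.one_lt.le
    have hmod : ((p - 1 : ℕ) : ℤ) ≡ -1 [ZMOD p] := by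
      rw [Int.modEq_iff_dvd]; push_cast [Nat.cast_sub hp1]; exact ⟨-1, by ring⟩
    have h := hcon (p - 1)
    have hcongr : binValK k ((p - 1 : ℕ) : ℤ) 1 ≡ binValK k (-1) 1 [ZMOD p] := by
      unfold binValK
      exact (((Int.ModEq.refl _).mul (hmod.pow 2)).add (((Int.ModEq.refl _).mul hmod).mul
        (Int.ModEq.refl 1))).add (Int.ModEq.refl _)
    exact (Int.ModEq.dvd_iff hcongr).mp h
  simp only [binValK] at h0 h1 hm1
  have hk2 : (p : ℤ) ∣ k 2 := by simpa using h0
  have hpI : Prime (p : ℤ) := Nat.prime_iff_prime_int.mp hp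
  have hp2' : ¬ (p : ℤ) ∣ 2 := by
    intro h
    have : (p : ℤ) ≤ 2 := Int.le_of_dvd two_pos h
    have h2 : 2 ≤ p := hp.two_le
    omega
  have h64 : ¬ (p : ℤ) ∣ 64 := fun h ↦ hp2' (hpI.dvd_of_dvd_pow (show (p:ℤ) ∣ 2 ^ 6 by norm_num; exact h))
  have hsum : (p : ℤ) ∣ 64 * k 0 + 2 * k 2 := by
    have := dvd_add h1 hm1; push_cast at this; ring_nf at this ⊢; exact this
  have hdiff : (p : ℤ) ∣ 2 * k 1 := by
    have := dvd_sub h1 hm1; push_cast at this; ring_nf at this ⊢; exact this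
  have hk0 : (p : ℤ) ∣ k 0 := by
    have : (p : ℤ) ∣ 64 * k 0 := by
      have := dvd_sub hsum (dvd_mul_of_dvd_right hk2 2); ring_nf at this ⊢; exact this
    exact (hpI.dvd_or_dvd this).resolve_left h64
  have hk1 : (p : ℤ) ∣ k 1 := (hpI.dvd_or_dvd hdiff).resolve_left hp2'
  exact hk ⟨hk0, hk1, hk2⟩

/-- At `p = 2`: if `k₁` is odd, `Q_k(0,1) = k₂` or `Q_k(1,1) = 32k₀ + k₁ + k₂` is odd. [folklore] -/
theorem exists_binValK_odd {k : Fin 3 → ℤ} (hk1 : Odd (k 1)) : ∃ a : ℕ, ¬ (2 : ℤ) ∣ binValK k a 1 := by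
  by_cases h2 : (2 : ℤ) ∣ k 2
  · refine ⟨1, fun h ↦ ?_⟩
    simp only [binValK, Nat.cast_one] at h
    have : (2 : ℤ) ∣ k 1 := by
      have := dvd_sub (dvd_sub h h2) (dvd_mul_right 2 (16 * k 0)); ring_nf at this ⊢; exact this
    exact (Int.not_even_iff_odd.mpr hk1) (even_iff_two_dvd.mpr this)
  · exact ⟨0, by simpa [binValK] using h2⟩

/-- Polynomial congruence for `Q_k(·, 1)`. [folklore] -/
theorem binValK_modEq_of_modEq {k : Fin 3 → ℤ} {n s s' : ℤ} (h : s ≡ s' [ZMOD n]) :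
    binValK k s 1 ≡ binValK k s' 1 [ZMOD n] := by
  unfold binValK
  exact (((Int.ModEq.refl _).mul (h.pow 2)).add (((Int.ModEq.refl _).mul h).mul (Int.ModEq.refl 1))).add
    (Int.ModEq.refl _)

/-- **A value prime to a finite set of primes** (Chinese remainder, `2` allowed). [folklore] -/
theorem exists_binValK_not_dvd (S : Finset ℕ) (hS : ∀ p ∈ S, p.Prime) {k : Fin 3 → ℤ}
    (hk : ∀ p ∈ S, ∃ a : ℕ, ¬ (p : ℤ) ∣ binValK k a 1) :
    ∃ s : ℤ, ∀ p ∈ S, ¬ (p : ℤ) ∣ binValK k s 1 := by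
  classical
  choose! a ha using hk
  have hs0 : ∀ p ∈ S, (id p : ℕ) ≠ 0 := fun p hp ↦ (hS p hp).ne_zero
  have hpp : Set.Pairwise (S : Set ℕ) (Function.onFun Nat.Coprime id) := by
    intro p hp q hq hpq
    exact (Nat.coprime_primes (hS p hp) (hS q hq)).mpr hpq
  obtain ⟨c, hc⟩ := Nat.chineseRemainderOfFinset a id S hs0 hpp
  refine ⟨c, fun p hp h ↦ ha p hp ?_⟩
  have hmod : ((c : ℕ) : ℤ) ≡ ((a p : ℕ) : ℤ) [ZMOD (p : ℕ)] := Int.natCast_modEq_iff.mpr (hc p hp)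
  exact (Int.ModEq.dvd_iff (binValK_modEq_of_modEq hmod)).mp h

/-! ### The Jacobi-symbol identity -/

/-- **Reciprocity step**: for `r` odd, `N ≡ 1 (mod 4)`, `gcd(r, N) = gcd(r, s) = 1` and
`r ∣ L² - s² N`, `J(r | N) = 1`: `(r/N) = (N/|r|) = (s²N/|r|) = (L²/|r|) = 1`. [folklore] -/
theorem jacobiSym_eq_one_of_dvd_sq_sub_sq_mul {r s : ℤ} {N : ℕ} (hr : Odd r) (hN4 : N % 4 = 1)
    (hcop : r.gcd N = 1) (hcops : r.gcd s = 1) {L : ℤ} (hL : r ∣ L ^ 2 - s ^ 2 * N) :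
    jacobiSym r N = 1 := by
  set m : ℕ := r.natAbs with hm
  have hr0 : r ≠ 0 := by rintro rfl; exact (Int.not_even_iff_odd.mpr hr) ⟨0, by simp⟩
  have hmodd : Odd m := Int.natAbs_odd.mpr hr
  have hm0 : m ≠ 0 := Int.natAbs_ne_zero.mpr hr0
  have hNodd : Odd N := Nat.odd_iff.mpr (by omega)
  have h1 : jacobiSym r N = jacobiSym (m : ℤ) N := by
    rcases Int.natAbs_eq r with h | h
    · rw [← hm] at h; rw [← h]
    · rw [← hm] at h
      conv_lhs => rw [h]
      rw [jacobiSym.neg _ hNodd, ZMod.χ₄_nat_one_mod_four hN4]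
      simp
  have h2 : jacobiSym (m : ℤ) N = jacobiSym (N : ℤ) m :=
    (jacobiSym.quadratic_reciprocity_one_mod_four hN4 hmodd).symm
  -- insert the square `s²`
  have hsm : s.gcd m = 1 := by
    rw [hm]
    unfold Int.gcd
    rw [Int.natAbs_natCast, Nat.gcd_comm]
    exact hcops
  have h3 : jacobiSym (N : ℤ) m = jacobiSym (s ^ 2 * N : ℤ) m := by
    rw [jacobiSym.mul_left, jacobiSym.sq_one' hsm, one_mul]
  have hmdvd : (m : ℤ) ∣ L ^ 2 - s ^ 2 * N := Int.natAbs_dvd.mpr hL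
  have h4 : jacobiSym (s ^ 2 * N : ℤ) m = jacobiSym (L ^ 2) m := by
    apply jacobiSym.mod_left'
    have : L ^ 2 ≡ s ^ 2 * N [ZMOD (m : ℕ)] := by
      rw [Int.modEq_iff_dvd]
      have : (m : ℤ) ∣ -(L ^ 2 - s ^ 2 * N) := (dvd_neg).mpr hmdvd
      simpa [neg_sub] using this
    exact this.symm
  have h5 : jacobiSym (L ^ 2) m = 1 := by
    apply jacobiSym.sq_one'
    by_contra hg
    obtain ⟨q, hq, hqg⟩ := Nat.exists_prime_and_dvd hg
    have hqL : (q : ℤ) ∣ L := (Int.natCast_dvd_natCast.mpr hqg).trans (Int.gcd_dvd_left L m)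
    have hqm : q ∣ m := by
      have h' : (q : ℤ) ∣ (m : ℤ) := (Int.natCast_dvd_natCast.mpr hqg).trans (Int.gcd_dvd_right L m)
      exact Int.natCast_dvd_natCast.mp h'
    have hqr : (q : ℤ) ∣ r := (Int.natCast_dvd_natCast.mpr hqm).trans (Int.natAbs_dvd.mpr dvd_rfl)
    have hqsN : (q : ℤ) ∣ s ^ 2 * N := by
      have hA : (q : ℤ) ∣ L ^ 2 := dvd_pow hqL two_ne_zero
      have hB : (q : ℤ) ∣ L ^ 2 - s ^ 2 * N := hqr.trans hL
      have := dvd_sub hA hB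
      simpa using this
    have hqI : Prime (q : ℤ) := Nat.prime_iff_prime_int.mp hq
    rcases hqI.dvd_or_dvd hqsN with hqs | hqN
    · have hqs' : (q : ℤ) ∣ s := hqI.dvd_of_dvd_pow hqs
      have hq1 : (q : ℤ) ∣ (r.gcd s : ℤ) := Int.dvd_coe_gcd hqr hqs'
      rw [hcops] at hq1
      exact hq.one_lt.ne' (Nat.dvd_one.mp (Int.natCast_dvd_natCast.mp hq1))
    · have hqN' : q ∣ N := Int.natCast_dvd_natCast.mp hqN
      have hq1 : q ∣ r.gcd N := Nat.dvd_gcd hqm hqN'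
      rw [hcop] at hq1
      exact hq.one_lt.ne' (Nat.dvd_one.mp hq1)
  rw [h1, h2, h3, h4, h5]

/-! ### Products of Kohnen symbols are Jacobi symbols -/

/-- **`∏_{p ∣ m} χ_p(Q_k) = (r/m)`** for square-free odd `m ∣ Δ(k)` and a value `r = Q_k(σ, τ)` prime
to `m`. [folklore] -/
theorem prod_kohnenSym_eq_jacobiSym {m : ℕ} (hm : Squarefree m) (hmodd : Odd m) {k : Fin 3 → ℤ}
    (hn : (m : ℤ) ∣ discK k) {σ τ : ℤ} (hval : ∀ p ∈ m.primeFactors, ¬ (p : ℤ) ∣ binValK k σ τ) :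
    ∏ p ∈ m.primeFactors, kohnenSym p k = jacobiSym (binValK k σ τ) m := by
  conv_rhs => rw [← Nat.prod_primeFactors_of_squarefree hm]
  rw [jacobiSym_prod_primes _ _ fun p hp ↦ Nat.prime_of_mem_primeFactors hp]
  refine prod_congr rfl fun p hp ↦ ?_
  have hpp : p.Prime := Nat.prime_of_mem_primeFactors hp
  haveI : Fact p.Prime := ⟨hpp⟩
  have hp2 : p ≠ 2 := by
    rintro rfl
    exact (Nat.not_even_iff_odd.mpr hmodd) (even_iff_two_dvd.mpr (Nat.dvd_of_mem_primeFactors hp))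
  have hpn : (p : ℤ) ∣ discK k := (Int.natCast_dvd_natCast.mpr (Nat.dvd_of_mem_primeFactors hp)).trans hn
  exact kohnenSym_eq_jacobiSym_binValK hp2 hpn (hval p hp)

/-- **Multiplicativity of Kohnen's weight** for coprime `a, b`. [folklore] -/
theorem kohnenWt_mul {a b : ℕ} (hab : a.Coprime b) (ha : a ≠ 0) (hb : b ≠ 0) (k : Fin 3 → ℤ) :
    kohnenWt (a * b) k = kohnenWt a k * kohnenWt b k := by
  unfold kohnenWt
  rw [Nat.primeFactors_mul ha hb, Finset.prod_union hab.disjoint_primeFactors]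

/-- If a prime `p` divides `k₀, k₁, k₂` then `p² ∣ Δ(k)`. [folklore] -/
theorem sq_dvd_discK_of_dvd {p : ℤ} {k : Fin 3 → ℤ} (h0 : p ∣ k 0) (h1 : p ∣ k 1) (h2 : p ∣ k 2) :
    p ^ 2 ∣ discK k := by
  obtain ⟨a, ha⟩ := h0; obtain ⟨b, hb⟩ := h1; obtain ⟨c, hc⟩ := h2
  exact ⟨b ^ 2 - 128 * a * c, by rw [discK, ha, hb, hc]; ring⟩

/-! ### Triviality on a square class -/

/-- **Genus characters are trivial on a square class**: for odd square-free `m ≡ 1 (mod 4)`, `s` odd,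
and `k` with `Δ(k) = s² m` that is non-degenerate modulo the primes of `s`, `χ_m(Q_k) = 1`.
[cite: Shintani1975, §2, Thm. 2] -/
theorem kohnenWt_eq_one_of_discK_eq_sq_mul {m : ℕ} (hm : Squarefree m) (hm4 : m % 4 = 1) {s : ℤ}
    (hs : Odd s) {k : Fin 3 → ℤ} (hΔ : discK k = s ^ 2 * m)
    (hnd : ∀ p : ℕ, p.Prime → (p : ℤ) ∣ s → ¬ ((p : ℤ) ∣ k 0 ∧ (p : ℤ) ∣ k 1 ∧ (p : ℤ) ∣ k 2)) :
    kohnenWt m k = 1 := by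
  classical
  have hm0 : m ≠ 0 := hm.ne_zero
  have hmodd : Odd m := Nat.odd_iff.mpr (by omega)
  have hs0 : s ≠ 0 := by rintro rfl; exact (Int.not_even_iff_odd.mpr hs) ⟨0, by simp⟩
  have hmn : (m : ℤ) ∣ discK k := ⟨s ^ 2, by rw [hΔ]; ring⟩
  -- `k₁` is odd
  have hk1 : Odd (k 1) := by
    have hΔodd : Odd (discK k) := by
      rw [hΔ]; exact (hs.pow).mul (by exact_mod_cast hmodd)
    have hsq : Odd (k 1 * k 1) := by
      have e : k 1 * k 1 = discK k + 128 * k 0 * k 2 := by rw [discK]; ring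
      rw [e]
      exact hΔodd.add_even ⟨64 * k 0 * k 2, by ring⟩
    exact Int.Odd.of_mul_left hsq
  -- the set of primes to avoid
  set S : Finset ℕ := (2 * s.natAbs * m).primeFactors with hSdef
  have hS : ∀ p ∈ S, p.Prime := fun p hp ↦ Nat.prime_of_mem_primeFactors hp
  have hchoice : ∀ p ∈ S, ∃ a : ℕ, ¬ (p : ℤ) ∣ binValK k a 1 := by
    intro p hp
    have hpp := hS p hp
    by_cases hp2 : p = 2
    · subst hp2; exact_mod_cast exists_binValK_odd hk1
    · refine exists_binValK_not_dvd_of_prime hpp hp2 fun ⟨h0, h1, h2⟩ ↦ ?_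
      by_cases hps : (p : ℤ) ∣ s
      · exact hnd p hpp hps ⟨h0, h1, h2⟩
      · -- `p ∣ m` (as `p ∣ 2 s m`, `p ≠ 2`, `p ∤ s`), but then `p² ∣ Δ = s² m` forces `p² ∣ m`
        have hpdvd : p ∣ 2 * s.natAbs * m := Nat.dvd_of_mem_primeFactors hp
        have hpI : Prime (p : ℤ) := Nat.prime_iff_prime_int.mp hpp
        have hpm : p ∣ m := by
          have h' : (p : ℤ) ∣ 2 * |s| * (m : ℤ) := by
            have : (p : ℤ) ∣ ((2 * s.natAbs * m : ℕ) : ℤ) := Int.natCast_dvd_natCast.mpr hpdvd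
            push_cast at this
            exact this
          rcases hpI.dvd_or_dvd h' with h2s | hm'
          · rcases hpI.dvd_or_dvd h2s with h2 | hs'
            · exfalso
              have : (p : ℤ) ≤ 2 := Int.le_of_dvd two_pos h2
              have := hpp.two_le
              omega
            · exact absurd ((dvd_abs _ _).mp hs') hps
          · exact Int.natCast_dvd_natCast.mp hm'
        have hsq : (p : ℤ) ^ 2 ∣ discK k := sq_dvd_discK_of_dvd h0 h1 h2
        rw [hΔ] at hsq
        -- `p² ∣ s² m` with `p ∤ s` gives `p² ∣ m`
        have hp2m : (p : ℤ) ^ 2 ∣ (m : ℤ) := by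
          have hcop1 : IsCoprime (p : ℤ) s := hpI.irreducible.coprime_iff_not_dvd.mpr hps
          have hcop : IsCoprime ((p : ℤ) ^ 2) (s ^ 2) := hcop1.pow
          exact hcop.dvd_of_dvd_mul_left hsq
        have : p * p ∣ m := by
          have := Int.natCast_dvd_natCast.mp (show ((p * p : ℕ) : ℤ) ∣ (m : ℤ) by push_cast; rw [← sq]; exact hp2m)
          exact this
        exact hpp.one_lt.ne' (Nat.isUnit_iff.mp (hm p this))
  obtain ⟨σ, hσ⟩ := exists_binValK_not_dvd S hS hchoice
  have hmemS : ∀ {p : ℕ}, p.Prime → p ∣ 2 * s.natAbs * m → p ∈ S := fun hp hdvd ↦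
    Nat.mem_primeFactors.mpr ⟨hp, hdvd, by positivity⟩
  -- `r = Q_k(σ, 1)` is odd, prime to `m` and to `s`
  have h2r : ¬ (2 : ℤ) ∣ binValK k σ 1 := by
    exact_mod_cast hσ 2 (hmemS Nat.prime_two ⟨s.natAbs * m, by ring⟩)
  have hrodd : Odd (binValK k σ 1) := Int.not_even_iff_odd.mp (fun h ↦ h2r (even_iff_two_dvd.mp h))
  have hcopm : (binValK k σ 1).gcd m = 1 := by
    by_contra hg
    obtain ⟨q, hq, hqg⟩ := Nat.exists_prime_and_dvd hg
    have hqr : (q : ℤ) ∣ binValK k σ 1 :=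
      (Int.natCast_dvd_natCast.mpr hqg).trans (Int.gcd_dvd_left (binValK k σ 1) m)
    have hqm : q ∣ m := by
      have := (Int.natCast_dvd_natCast.mpr hqg).trans (Int.gcd_dvd_right (binValK k σ 1) m)
      exact_mod_cast this
    exact hσ q (hmemS hq (hqm.mul_left _)) hqr
  have hcops : (binValK k σ 1).gcd s = 1 := by
    by_contra hg
    obtain ⟨q, hq, hqg⟩ := Nat.exists_prime_and_dvd hg
    have hqr : (q : ℤ) ∣ binValK k σ 1 :=
      (Int.natCast_dvd_natCast.mpr hqg).trans (Int.gcd_dvd_left (binValK k σ 1) s)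
    have hqs : q ∣ s.natAbs := by
      have := (Int.natCast_dvd_natCast.mpr hqg).trans (Int.gcd_dvd_right (binValK k σ 1) s)
      exact Int.natCast_dvd.mp this
    exact hσ q (hmemS hq ((hqs.mul_left 2).mul_right m)) hqr
  -- `χ_m(Q_k) = (r/m) = 1`
  have hvalm : ∀ p ∈ m.primeFactors, ¬ (p : ℤ) ∣ binValK k σ 1 := fun p hp ↦
    hσ p (hmemS (Nat.prime_of_mem_primeFactors hp) ((Nat.dvd_of_mem_primeFactors hp).mul_left _))
  unfold kohnenWt
  rw [prod_kohnenSym_eq_jacobiSym hm hmodd hmn hvalm]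
  refine jacobiSym_eq_one_of_dvd_sq_sub_sq_mul hrodd hm4 hcopm hcops (L := 64 * k 0 * σ + k 1) ?_
  refine ⟨128 * k 0, ?_⟩
  have := mul_binValK_eq k σ 1
  rw [hΔ] at this
  linear_combination (-1 : ℤ) * this

/-! ### Consequences: the two symmetries of the endgame -/

/-- **Class `1`**: `χ_D(Q_k) = 1` whenever `Δ(k) = D` (`D ≡ 1 (mod 4)` square-free). [cite: Shintani1975, §2, Thm. 2] -/
theorem kohnenWt_eq_one_of_discK_eq {D : ℕ} (hD : Squarefree D) (hD4 : D % 4 = 1) {k : Fin 3 → ℤ}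
    (hΔ : discK k = D) : kohnenWt D k = 1 :=
  kohnenWt_eq_one_of_discK_eq_sq_mul hD hD4 odd_one (by rw [hΔ]; ring)
    (fun p hp hps ↦ absurd (Int.eq_one_of_dvd_one (by positivity) hps) (by exact_mod_cast hp.one_lt.ne'))

/-- `kohnenWt 1 = 1`. [folklore] -/
theorem kohnenWt_one (k : Fin 3 → ℤ) : kohnenWt 1 k = 1 := by simp [kohnenWt]

/-- `kohnenWt 3 = kohnenSym 3`. [folklore] -/
theorem kohnenWt_three (k : Fin 3 → ℤ) : kohnenWt 3 k = kohnenSym 3 k := by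
  rw [kohnenWt, Nat.Prime.primeFactors Nat.prime_three, Finset.prod_singleton]

/-- **Class `3`, auxiliary index `3`**: `χ_{D*}(Q_k) = χ_{-3}(Q_k)` whenever `Δ(k) = 3D`
(`D ≡ 3 (mod 8)` square-free; `3 ∣ D` allowed). [cite: Shintani1975, §2, Thm. 2] -/
theorem kohnenWt_eq_kohnenWt_three {D : ℕ} (hD : Squarefree D) (hD8 : D % 8 = 3) {k : Fin 3 → ℤ}
    (hΔ : discK k = 3 * D) : kohnenWt D k = kohnenWt 3 k := by
  by_cases h3 : 3 ∣ D
  · -- `D = 3 m`, `Δ = 3² m`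
    obtain ⟨m, rfl⟩ := h3
    have hm : Squarefree m := hD.of_mul_right
    have hcop : Nat.Coprime 3 m := by
      rw [Nat.Prime.coprime_iff_not_dvd Nat.prime_three]
      intro h
      obtain ⟨t, rfl⟩ := h
      have := hD 3 ⟨t, by ring⟩
      simp at this
    have hm0 : m ≠ 0 := hm.ne_zero
    have hm8 : m % 4 = 1 := by omega
    rw [kohnenWt_mul hcop (by norm_num) hm0, kohnenWt_three]
    by_cases hdeg : (3 : ℤ) ∣ k 0 ∧ (3 : ℤ) ∣ k 1 ∧ (3 : ℤ) ∣ k 2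
    · -- degenerate modulo `3`: `χ₃ = 0` on both sides
      have h0 : kohnenSym 3 k = 0 := by
        have h3Δ : ((3 : ℕ) : ℤ) ∣ discK k := ⟨3 * m, by rw [hΔ]; push_cast; ring⟩
        have hk2 : k 2 ≡ 0 [ZMOD (3 : ℕ)] := Int.modEq_zero_iff_dvd.mpr (by exact_mod_cast hdeg.2.2)
        unfold kohnenSym
        rw [if_pos h3Δ, if_pos (by exact_mod_cast hdeg.1), jacobiSym.mod_left' hk2,
          jacobiSym.zero_left (by norm_num)]
      rw [h0, zero_mul]
    · have h1 : kohnenWt m k = 1 :=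
        kohnenWt_eq_one_of_discK_eq_sq_mul hm hm8 (s := 3) (by decide) (by rw [hΔ]; push_cast; ring)
          (fun p hp hp3 hk ↦ by
            have hp3' : p ∣ 3 := by exact_mod_cast hp3
            have := (Nat.prime_dvd_prime_iff_eq hp Nat.prime_three).mp hp3'
            subst this
            exact hdeg (by exact_mod_cast hk))
      rw [h1, mul_one]
  · have hcop : Nat.Coprime 3 D := (Nat.Prime.coprime_iff_not_dvd Nat.prime_three).mpr h3
    have h3D : Squarefree (3 * D) := (Nat.squarefree_mul hcop).mpr ⟨Nat.prime_three.squarefree, hD⟩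
    have h1 : kohnenWt (3 * D) k = 1 :=
      kohnenWt_eq_one_of_discK_eq_sq_mul h3D (by omega) odd_one (by rw [hΔ]; push_cast; ring)
        (fun p hp hps ↦ absurd (Int.eq_one_of_dvd_one (by positivity) hps) (by exact_mod_cast hp.one_lt.ne'))
    rw [kohnenWt_mul hcop (by norm_num) hD.ne_zero] at h1
    exact (Int.eq_of_mul_eq_one h1).symm

end Literature.NumberTheory.EllipticCurves.Shintani
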